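import Summits.BirchSwinnertonDyer.Rank1Residual.X11b.BDPRouteRigidity
import Summits.BirchSwinnertonDyer.Rank1Residual.X11b.BDPRouteOddPrimeClass
import Summits.BirchSwinnertonDyer.Rank1Residual.X11b.Three.StepLAtThree
import HarnessLib

/-!
# X11b, the INDEX-CERT consumer in certificate shape: `p ∤ [E(K) : ℤ·P_K]` at ONE odd Heegner datum
# on the atom A1 ∧ (ram) ⇒ `BSD(E,p)` (cell `b2b-bsdres`, team `x11b3` = N8/O2, seat p5; sub-target S17
# of LEAD DEAL #6 R6-6)

HONEST FRAMING (cell `b2b-bsdres`, run/shared/lean/b2b/bsd-rank1-residual/, verbatim in every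
file): the goal of the cell is to DELETE the COMBINATION-SHAPED residual classes of the
Birch–Swinnerton-Dyer formula for ALL analytic-rank `≤ 1` elliptic curves over `ℚ` — "full BSD
formula for every rank `≤ 1` curve in class `C`" assembled STRICTLY from published theorems — so
that the rank-`≤ 1` remainder becomes exactly the CONSTRUCTION-SHAPED classes, which are TYPED
(missing-input `Prop`s), NOT attempted. This is not "finishing BSD". Team `x11b3` (X11b, STEP L at
`3 ∥ N`) is a RESEARCH team; no claim beyond the stated class and atom; X11b and X11 ∧ `r = 1` ∧
`p = 3` stay CONSTRUCTION-SHAPED (REFEREE R6.2); nothing here is booked (the lane books); no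
census is read here. THEOREMS ONLY (no definition, no named fact, no `sorry`).

## What this file does

A certificate-shaped typed ENDPOINT, like K-CERT3 (`Three/McCallumCertificate.lean`, p250667), for
the route's single-datum theorem `bsdp_of_indexLowerBoundAt_of_heegnerData_of_odd`
(`X11b/BDPRouteRigidity.lean` §"One datum suffices"): on the atom A1 ∧ (ram) — `ClassX11b W p`,
`Ram W p`, `p ∤ ∏_ℓ c_ℓ(E)` — STEP L is needed at ONE odd Heegner datum only, and STEP L at a datum,
`IndexLowerBoundAt W p K P := 2·ord_p [E(K) : ℤ·P] ≤ ord_p #Ш(E/K) + 2·ord_p ∏_ℓ c_ℓ(E)`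
(`X11b/BDPRoute.lean`), holds TRIVIALLY when `p ∤ [E(K) : ℤ·P]` (left-hand side `0`). So:

* §1 `indexLowerBoundAt_of_not_dvd_index` (every `p`, every point `P`, no Heegner hypothesis): the
  certificate `¬ p ∣ (AddSubgroup.zmultiples P).index` gives `IndexLowerBoundAt W p K P`. The
  certificate is stated as NON-divisibility, not as `padicValNat p index = 0`, so the degenerate
  case `index = 0` (`P` of infinite index, e.g. torsion or `E(K)` of rank `≥ 2`) is excluded by the
  certificate itself (`p ∣ 0`).
* §2 `bsdp_of_heegnerIndexCertificate` (every odd `p`): the single-datum theorem composed with §1 —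
  datum binders VERBATIM from `BDPRouteRigidity.lean` (a modular parametrisation `Dt` of level `N_E`,
  an imaginary quadratic `K` with ODD `d_K` satisfying the Heegner hypothesis for `N_E`, the Heegner
  point `P` with `P ↦ heegnerPointComplex Dt H` under `ι : K → ℂ`, `p ∤ c(Dt)` (Manin; kept a
  binder), `p ∤ #𝓞_K^×`, `L(E^{d_K},1) ≠ 0`, a minimal model `Wd` of the twist); published inputs
  Gross–Zagier, Kolyvagin (qualitative + Thm. A / McCallum's bound `hB`, `ρ̄` onto — automatic from
  irr + (ram)), Skinner 2016 Thm. C (`p ≥ 3`, for the rank-zero twist), GZK, modularity. This is an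
  **A1 ∧ (ram) consumer** (`htam0 : ¬ p ∣ ∏c`): it says NOTHING about (T2′) cells or the corner.
* §3 the `p = 3` rows (`IsX11Three` / `ClassX11b W 3`), where `3 ∤ #𝓞_K^×` is a THEOREM for a
  Heegner field of a `3 ∣ N` curve (`Three.not_dvd_discr_and_not_dvd_torsionOrder_of_heegner`,
  `StepLAtThree.lean`) and is discharged.

WHAT IT IS FOR (EVIDENCE context, numbers of record elsewhere, nothing booked here): the x11b3 lead's
question D-a″ (LEAD DEAL #6 R6-5) to referee A — whether a Gross–Zagier-derived, two-engine,
tail-bounded certificate "`3 ∤ I_K` at ONE admissible `K`" is an ADMISSIBLE per-pair input — would,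
if answered YES, make this file the kernel record shape for the 1 081 X11b@3 cells of the A1 ∧ (ram)
∧ `3 ∤ #Ш_an` population (`cells/x11b3/E-K6-A1RAM3-UNIT.tsv`); if NO, the file stays an idle typed
endpoint. Whether such a certificate is admissible, and at what tier, is referee A's; ODD `d_K` only
(even `d_K` needs the Barrios-et-al. transport of `Three/UpperShimuraTwoAdic.lean`).

References: [JetchevSkinnerWan2017] §7.4.1 (eq:shalowerK-1); [Castella2018] (1.1), (5.2)–(5.3);
[GrossZagier1986] I (6.5), V (2.1)–(2.2); [GrossLMS1991] (2.1)–(2.3), Thm. 1.3; [McCallumLMS1991] §1;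
[Skinner2016PacificMC] Thm. C and footnote 1; [Mazur1978] Cor. 4.1; [Miller2011LMS] Def. 1.1;
cell files `X11b/BDPRoute.lean`, `X11b/BDPRouteRigidity.lean`, `X11b/Three/McCallumCertificate.lean`,
`X11b/Three/StepLAtThree.lean`.
-/

noncomputable section

open scoped Classical

open WeierstrassCurve NumberField Literature.NumberTheory.EllipticCurves
  Literature.NumberTheory.EllipticCurves.ModularForms
  Literature.NumberTheory.EllipticCurves.Rank1Residual
  Literature.NumberTheory.EllipticCurves.Rank1Residual.Typed

namespace Summit.BirchSwinnertonDyer.Rank1Residual.X11b.Three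

/-! ### §1. The certificate `p ∤ [E(K) : ℤ·P]` gives STEP L at the datum trivially -/

section Certificate

variable (W : WeierstrassCurve ℚ) (p : ℕ) (K : Type) [Field K] [NumberField K]
  (P : (W.baseChange K).toAffine.Point)

/-- **`p ∤ [E(K) : ℤ·P]` ⇒ `IndexLowerBoundAt W p K P`** (every `p`, every number field `K`, every
point `P`; no Heegner hypothesis): the typed STEP-L inequality
`2·ord_p [E(K) : ℤ·P] ≤ ord_p #Ш(E/K) + 2·ord_p ∏_ℓ c_ℓ(E)` has left-hand side `0`. The hypothesis
is NON-divisibility, so `[E(K) : ℤ·P] = 0` (infinite index) is excluded by the certificate itself.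
Bookkeeping. [cite: JetchevSkinnerWan2017, §7.4.1 (eq:shalowerK-1), p. 30] [cite: Castella2018, (1.1) (p. 2)] -/
theorem indexLowerBoundAt_of_not_dvd_index (h : ¬ p ∣ (AddSubgroup.zmultiples P).index) :
    IndexLowerBoundAt W p K P := by
  unfold IndexLowerBoundAt
  rw [padicValNat.eq_zero_of_not_dvd h, mul_zero]
  exact Nat.zero_le _

end Certificate

/-! ### §2. Atom A1 ∧ (ram), every odd `p`: ONE odd Heegner datum with `p ∤ [E(K) : ℤ·P_K]` ⇒ `BSD(E,p)` -/

section OddPrime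

/-- **X11b ∧ (ram) ∧ `p ∤ ∏c_ℓ`, EVERY ODD PRIME: `BSD(E,p)` from PUBLISHED theorems plus ONE
Heegner-index CERTIFICATE `p ∤ [E(K) : ℤ·P_K]` at ONE Heegner datum with `d_K` odd** — the route's
single-datum theorem `bsdp_of_indexLowerBoundAt_of_heegnerData_of_odd` (Gross–Zagier `hGZ`,
Kolyvagin `hKo` + Thm. A / McCallum's bound `hB` with `ρ̄_{E,p}` onto — automatic from irr(p) +
(ram) —, Skinner 2016 Thm. C `hSk` for the rank-zero twist `E^{d_K}` [`p ≥ 3`], GZK `hGZK`, modularity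
`hmod`) with STEP L at the datum supplied by `indexLowerBoundAt_of_not_dvd_index`. Datum binders
verbatim from that theorem: `Dt` a modular parametrisation of level `N_E`, `K` imaginary quadratic
with ODD `d_K` and the Heegner hypothesis for `N_E`, `P ∈ E(K)` mapping to the Heegner point
`heegnerPointComplex Dt H` under `ι`, `p ∤ c(Dt)` (Manin constant — a binder; Mazur 1978 discharges
it only for the optimal parametrisation), `p ∤ #𝓞_K^×`, `L(E^{d_K},1) ≠ 0`, `Wd` a minimal model of
the twist. An **A1 ∧ (ram) consumer** — nothing is claimed on (T2′) cells or on the corner.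
Certificate-shaped typed endpoint (like K-CERT3, p250667): whether an `L`-value-derived index
certificate is ADMISSIBLE as the hypothesis `hI` is referee A's question D-a″ (LEAD DEAL #6 R6-5);
per pair; nothing booked; no census read here. [cite: JetchevSkinnerWan2017, §7.4.1–7.4.2 (pp. 30–31)]
[cite: GrossLMS1991, §1 Thm. 1.3 and (2.1)–(2.3)] [cite: McCallumLMS1991, §1 Theorem (Kolyvagin), p. 296]
[cite: Skinner2016PacificMC, Thm. C (§1) and footnote 1] [cite: Mazur1978, Cor. 4.1]
[cite: Miller2011LMS, §1 and Def. 1.1] -/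
theorem bsdp_of_heegnerIndexCertificate
    (W : WeierstrassCurve ℚ) [W.IsElliptic] [W.IsGloballyMinimal] (p : ℕ) [Fact p.Prime]
    [NeZero (W.conductorNorm ℤ)] (K : Type) [Field K] [NumberField K]
    (Dt : ModularParametrizationData W (W.conductorNorm ℤ))
    (H : HeegnerDatum (W.conductorNorm ℤ) (NumberField.discr K)) (ι : K →+* ℂ)
    (P : (W.baseChange K).toAffine.Point)
    -- the published inputs (named facts of the tree)
    (hGZ : gross_zagier (W.conductorNorm ℤ) W K) (hKo : kolyvagin (W.conductorNorm ℤ) W K)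
    (hB : Kolyvagin1990_padicValNat_card_sha_le (W.conductorNorm ℤ) W K)
    (hSk : Skinner2016.thmC_padicValRat_bsd_rank_zero)
    (hGZK : rank_eq_analyticRank_of_analyticRank_le_one) (hmod : hasEntireLFunction_rat)
    -- the pair, on the atom A1 ∧ (ram)
    (hX : ClassX11b W p) (hram : Ram W p) (htam0 : ¬ p ∣ W.tamagawaProduct)
    -- ONE Heegner datum with `d_K` odd
    (hK : IsImaginaryQuadratic K) (hodd : Odd (NumberField.discr K))
    (hHN : SatisfiesHeegnerHypothesis (W.conductorNorm ℤ) K)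
    (hP : WeierstrassCurve.Affine.Point.map ι.toRatAlgHom P = heegnerPointComplex Dt H)
    (hc : ¬ (p : ℤ) ∣ Dt.c) (hμ : ¬ p ∣ Units.torsionOrder K)
    (hLt : (W.quadraticTwist (NumberField.discr K : ℚ)).entireLFunction 1 ≠ 0)
    (Wd : WeierstrassCurve ℚ) [Wd.IsElliptic] [Wd.IsGloballyMinimal] (Cd : VariableChange ℚ)
    (hWd : Cd • W.quadraticTwist (NumberField.discr K : ℚ) = Wd)
    -- the CERTIFICATE: `p ∤ [E(K) : ℤ·P]`
    (hI : ¬ p ∣ (AddSubgroup.zmultiples P).index) : BSDp W p :=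
  bsdp_of_indexLowerBoundAt_of_heegnerData_of_odd W p K Dt H ι P hGZ hKo hB hSk hGZK hmod hX hram htam0
    hK hodd hHN hP hc hμ hLt Wd Cd hWd (indexLowerBoundAt_of_not_dvd_index W p K P hI)

end OddPrime

/-! ### §3. The `p = 3` rows: `3 ∤ #𝓞_K^×` discharged for a Heegner field of a `3 ∣ N` curve -/

section Three

/-- **X11b@3 ∧ (ram) ∧ `3 ∤ ∏c_ℓ` (`ClassX11b W 3`): ONE odd Heegner datum with
`3 ∤ [E(K) : ℤ·P_K]` ⇒ `BSD(E,3)`** — `bsdp_of_heegnerIndexCertificate` at `p = 3` with the binder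
`3 ∤ #𝓞_K^×` DISCHARGED: `3 ∣ N_E` (multiplicative reduction) splits in `K` by the Heegner hypothesis,
so `K ≠ ℚ(√−3)` (`Three.not_dvd_discr_and_not_dvd_torsionOrder_of_heegner`). Remaining per-pair
inputs: the datum (`Dt`, `K` with odd `d_K`, `P`, `ι`), `3 ∤ c(Dt)`, `L(E^{d_K},1) ≠ 0`, the twist's
minimal model, (ram), `3 ∤ ∏c_ℓ`, and the certificate `hI`. Certificate-shaped; admissibility of an
index certificate = referee A's D-a″; per pair; X11 ∧ `r = 1` ∧ `p = 3` stays CONSTRUCTION-SHAPED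
(R6.2); nothing booked. [cite: JetchevSkinnerWan2017, §7.4.1–7.4.2 (pp. 30–31)]
[cite: McCallumLMS1991, §1 Theorem (Kolyvagin), p. 296] [cite: Skinner2016PacificMC, Thm. C (§1) and footnote 1]
[cite: Miller2011LMS, §1 and Def. 1.1] -/
theorem ClassX11b.bsdp_three_of_heegnerIndexCertificate [Fact (Nat.Prime 3)]
    (W : WeierstrassCurve ℚ) [W.IsElliptic] [W.IsGloballyMinimal]
    [NeZero (W.conductorNorm ℤ)] (K : Type) [Field K] [NumberField K]
    (Dt : ModularParametrizationData W (W.conductorNorm ℤ))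
    (H : HeegnerDatum (W.conductorNorm ℤ) (NumberField.discr K)) (ι : K →+* ℂ)
    (P : (W.baseChange K).toAffine.Point)
    (hGZ : gross_zagier (W.conductorNorm ℤ) W K) (hKo : kolyvagin (W.conductorNorm ℤ) W K)
    (hB : Kolyvagin1990_padicValNat_card_sha_le (W.conductorNorm ℤ) W K)
    (hSk : Skinner2016.thmC_padicValRat_bsd_rank_zero)
    (hGZK : rank_eq_analyticRank_of_analyticRank_le_one) (hmod : hasEntireLFunction_rat)
    (hX : ClassX11b W 3) (hram : Ram W 3) (htam0 : ¬ 3 ∣ W.tamagawaProduct)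
    (hK : IsImaginaryQuadratic K) (hodd : Odd (NumberField.discr K))
    (hHN : SatisfiesHeegnerHypothesis (W.conductorNorm ℤ) K)
    (hP : WeierstrassCurve.Affine.Point.map ι.toRatAlgHom P = heegnerPointComplex Dt H)
    (hc : ¬ (3 : ℤ) ∣ Dt.c)
    (hLt : (W.quadraticTwist (NumberField.discr K : ℚ)).entireLFunction 1 ≠ 0)
    (Wd : WeierstrassCurve ℚ) [Wd.IsElliptic] [Wd.IsGloballyMinimal] (Cd : VariableChange ℚ)
    (hWd : Cd • W.quadraticTwist (NumberField.discr K : ℚ) = Wd)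
    (hI : ¬ 3 ∣ (AddSubgroup.zmultiples P).index) : BSDp W 3 :=
  have hμ : ¬ 3 ∣ Units.torsionOrder K :=
    (not_dvd_discr_and_not_dvd_torsionOrder_of_heegner hK hHN (p := 3) (by decide)
      (dvd_conductorNorm_of_classX11b hX)).2
  bsdp_of_heegnerIndexCertificate W 3 K Dt H ι P hGZ hKo hB hSk hGZK hmod hX hram htam0 hK hodd hHN hP
    (by exact_mod_cast hc) hμ hLt Wd Cd hWd hI

/-- **The same in the vocabulary of `IsX11Three`** (`mult(3) ∧ irr(3) ∧ r_an = 1`,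
`Rank1Residual/X11Three.lean`; `IsX11Three W` is `ClassX11b W 3`, `classX11b_three_of_isX11Three`):
ONE odd Heegner datum on an A1 ∧ (ram) pair with `3 ∤ [E(K) : ℤ·P_K]` ⇒ `BSD(E,3)`. Certificate-shaped
typed endpoint; per pair; nothing booked. [cite: JetchevSkinnerWan2017, §7.4.1–7.4.2 (pp. 30–31)]
[cite: Skinner2016PacificMC, Thm. C (§1) and footnote 1] [cite: Miller2011LMS, §1 and Def. 1.1] -/
theorem IsX11Three.bsdp_of_heegnerIndexCertificate [Fact (Nat.Prime 3)]
    (W : WeierstrassCurve ℚ) [W.IsElliptic] [W.IsGloballyMinimal]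
    [NeZero (W.conductorNorm ℤ)] (K : Type) [Field K] [NumberField K]
    (Dt : ModularParametrizationData W (W.conductorNorm ℤ))
    (H : HeegnerDatum (W.conductorNorm ℤ) (NumberField.discr K)) (ι : K →+* ℂ)
    (P : (W.baseChange K).toAffine.Point)
    (hGZ : gross_zagier (W.conductorNorm ℤ) W K) (hKo : kolyvagin (W.conductorNorm ℤ) W K)
    (hB : Kolyvagin1990_padicValNat_card_sha_le (W.conductorNorm ℤ) W K)
    (hSk : Skinner2016.thmC_padicValRat_bsd_rank_zero)
    (hGZK : rank_eq_analyticRank_of_analyticRank_le_one) (hmod : hasEntireLFunction_rat)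
    (hX : IsX11Three W) (hram : Ram W 3) (htam0 : ¬ 3 ∣ W.tamagawaProduct)
    (hK : IsImaginaryQuadratic K) (hodd : Odd (NumberField.discr K))
    (hHN : SatisfiesHeegnerHypothesis (W.conductorNorm ℤ) K)
    (hP : WeierstrassCurve.Affine.Point.map ι.toRatAlgHom P = heegnerPointComplex Dt H)
    (hc : ¬ (3 : ℤ) ∣ Dt.c)
    (hLt : (W.quadraticTwist (NumberField.discr K : ℚ)).entireLFunction 1 ≠ 0)
    (Wd : WeierstrassCurve ℚ) [Wd.IsElliptic] [Wd.IsGloballyMinimal] (Cd : VariableChange ℚ)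
    (hWd : Cd • W.quadraticTwist (NumberField.discr K : ℚ) = Wd)
    (hI : ¬ 3 ∣ (AddSubgroup.zmultiples P).index) : BSDp W 3 :=
  ClassX11b.bsdp_three_of_heegnerIndexCertificate W K Dt H ι P hGZ hKo hB hSk hGZK hmod
    (classX11b_three_of_isX11Three W hX) hram htam0 hK hodd hHN hP hc hLt Wd Cd hWd hI

end Three

end Summit.BirchSwinnertonDyer.Rank1Residual.X11b.Three

end
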